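import Mathlib
import Summits.Ventures.PercRepro2.SeriesContractHMF
import Summits.Ventures.PercRepro2.HMFLeafIso
import Summits.Ventures.PercRepro2.A3LeafQuadratic

/-!
# The attachment coefficient `κ` transports along a series edge (blind cell PercRepro2, night-1
g15; NIGHT1-G15.md §3″ — the (G1) row of S3 at a degree-two vertex)

Let `a₃` be a leaf with edge `f = {a₃, v}`, `v` unmarked with exactly `f` and `f' = {v, x}`
(`x` arbitrary, `t = p f'`).  The attachment coefficient of the (HMF) leaf step at `v`,
`κ_v = 4·HMFc(p[f ↦ ½]) − 2·HMFc(p[f ↦ 1])` (`HMFLeafStep.HMF_of_leaf_step`), equals `t²` times the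
attachment coefficient `κ_x` of the instance in which `a₃` hangs at `x` by the re-ended edge `f`
and `v` is isolated (`f'` at weight `0`):

  **`kappa_series : κ_v = (p f')² · κ_x`** (`HMFc_leaf_series`: `HMFc(p[f ↦ s]) = Ψ(s · p f')`).

Proof: the series reduction `SeriesCollapse.HMFc_series` (weight `s·t` on `f`, `f'` sure), the
re-ending across the sure edge `HMFc_reend_of_sure`, the invisible leaf `v`
(`HMFLeafInvisible.HMFc_update_leaf`), and the quadratic leaf identity `HMFLeafStep.HMFc_leaf_eq`
at `x` with `HMFLeafStep.HMFc_update_zero` (`Ψ(0) = 0`).  So the row `κ ≥ 0` of S3 (G1) at a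
degree-two `v` follows from the row at its neighbour `x` — NIGHT1-G7 §7's «κ(path) = (Π p)²·κ(u)»
in the kernel.
-/

open scoped Classical

namespace Summit.Ventures.PercRepro2

open UnionCluster CovForm PendantRoot

namespace SeriesCollapse

section Kappa

variable {V : Type*} {E : Type*} [Fintype E] [DecidableEq E] [Fintype V] [DecidableEq V]
  {R : Type*} [Field R] [LinearOrder R] [IsStrictOrderedRing R]

variable (p : E → R) (ends : E → Sym2 V) {f f' : E} {a₃ v x : V}

/-- **The mean field along the leaf weight of a pendant path `a₃ – v – x`** is the mean field of
the instance `a₃` pendant at `x` along the product weight: `HMFc(p[f ↦ s]) = Ψ(s · p f')`, where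
`Ψ(σ) = HMFc(p[f' ↦ 0][f ↦ σ]) ends[f ↦ {a₃, x}]`. -/
theorem HMFc_leaf_series (hp : IsProbVec p) (hff : f ≠ f') (hf : ends f = s(a₃, v))
    (hf' : ends f' = s(v, x)) (hdeg : ∀ e, v ∈ ends e → e = f ∨ e = f') (h3v : a₃ ≠ v)
    (hvx : v ≠ x) {o a₁ a₂ b : V} (hvo : v ≠ o) (hv1 : v ≠ a₁) (hv2 : v ≠ a₂) (hvb : v ≠ b)
    (s : R) (hs0 : 0 ≤ s) (hs1 : s ≤ 1) :
    HMFc (Function.update p f s) ends o a₁ a₂ a₃ b =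
      HMFc (Function.update (Function.update p f' 0) f (s * p f'))
        (Function.update ends f s(a₃, x)) o a₁ a₂ a₃ b := by
  have hfv : ends f = s(v, a₃) := by rw [hf, Sym2.eq_swap]
  -- the series reduction at `v`: `f ↦ s · t`, `f'` sure
  have h1 := HMFc_series (Function.update p f s) hff hfv hf' hdeg h3v.symm hvx hvo.symm hv1.symm
    hv2.symm h3v hvb.symm (o := o) (a₁ := a₁) (a₂ := a₂) (a₃ := a₃) (b := b)
  rw [Function.update_self, Function.update_of_ne hff.symm, Function.update_idem] at h1
  rw [← h1]
  -- the sure `f'` re-ends `f` to `{a₃, x}`; then `v` is an invisible leaf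
  have hp₁ : IsProbVec (Function.update (Function.update p f (s * p f')) f' 1) :=
    (hp.update f (mul_nonneg hs0 (hp.nonneg f')) (mul_le_one₀ hs1 (hp.nonneg f') (hp.le_one f'))).update
      f' zero_le_one le_rfl
  have hsure : (Function.update (Function.update p f (s * p f')) f' 1) f' = 1 := Function.update_self ..
  rw [HMFc_reend_of_sure _ hp₁ hsure hff hfv hf' hdeg h3v.symm hvx hvo.symm hv1.symm hv2.symm h3v
    hvb.symm]
  have hf'' : (Function.update ends f s(a₃, x)) f' = s(v, x) := by
    rw [Function.update_of_ne hff.symm, hf']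
  have hleaf : ∀ e, v ∈ (Function.update ends f s(a₃, x)) e → e = f' :=
    leaf_of_reend (w := a₃) (w' := x) hdeg h3v.symm hvx
  have hp₂ : Function.update (Function.update p f' 0) f (s * p f') =
      Function.update (Function.update (Function.update p f (s * p f')) f' 1) f' 0 := by
    rw [Function.update_idem, Function.update_comm hff]
  rw [hp₂, HMFLeafInvisible.HMFc_update_leaf _ hf'' hleaf hvx hvo hv1 hv2 h3v.symm hvb 0]

/-- **`κ` transports along a series edge**: `κ_v = (p f')² · κ_x`. -/
theorem kappa_series (hp : IsProbVec p) (hff : f ≠ f') (hf : ends f = s(a₃, v))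
    (hf' : ends f' = s(v, x)) (hdeg : ∀ e, v ∈ ends e → e = f ∨ e = f') (h3v : a₃ ≠ v)
    (hvx : v ≠ x) (h3x : a₃ ≠ x) (hleaf3 : ∀ e, a₃ ∈ ends e → e = f) {o a₁ a₂ b : V} (hvo : v ≠ o)
    (hv1 : v ≠ a₁) (hv2 : v ≠ a₂) (hvb : v ≠ b) (h31 : a₃ ≠ a₁) (h32 : a₃ ≠ a₂) (ho3 : o ≠ a₃)
    (hb3 : b ≠ a₃) :
    4 * HMFc (Function.update p f (1 / 2)) ends o a₁ a₂ a₃ b -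
        2 * HMFc (Function.update p f 1) ends o a₁ a₂ a₃ b =
      (p f') ^ 2 *
        (4 * HMFc (Function.update (Function.update p f' 0) f (1 / 2))
            (Function.update ends f s(a₃, x)) o a₁ a₂ a₃ b -
          2 * HMFc (Function.update (Function.update p f' 0) f 1)
            (Function.update ends f s(a₃, x)) o a₁ a₂ a₃ b) := by
  set t := p f' with ht
  set q := Function.update p f' 0 with hq
  set ends' := Function.update ends f s(a₃, x) with hends'
  have hq0 : q f' = 0 := by rw [hq, Function.update_self]
  have hqp : IsProbVec q := hp.update f' le_rfl zero_le_one
  -- the instance `a₃` pendant at `x`: the leaf identity in the weight of `f`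
  have hfx : ends' f = s(a₃, x) := by rw [hends', Function.update_self]
  have hleaf' : ∀ e, a₃ ∈ ends' e → e = f := by
    intro e he
    by_cases hef : e = f
    · exact hef
    · rw [hends', Function.update_of_ne hef] at he
      exact hleaf3 e he
  have hquad := HMFLeafStep.HMFc_leaf_eq q ends' hfx hleaf' h3x h31 h32 ho3.symm hb3.symm
  have hzero : HMFc (Function.update q f 0) ends' o a₁ a₂ a₃ b = 0 :=
    HMFLeafStep.HMFc_update_zero q ends' hqp hfx hleaf' h3x h31 h32 ho3 hb3
  -- the two values of `κ_v` through the product weight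
  have e1 := HMFc_leaf_series p ends hp hff hf hf' hdeg h3v hvx hvo hv1 hv2 hvb (1 / 2 : R)
    (by norm_num) (by norm_num) (o := o) (a₁ := a₁) (a₂ := a₂) (b := b)
  have e2 := HMFc_leaf_series p ends hp hff hf hf' hdeg h3v hvx hvo hv1 hv2 hvb (1 : R)
    zero_le_one le_rfl (o := o) (a₁ := a₁) (a₂ := a₂) (b := b)
  rw [e1, e2]
  rw [← hq, ← hends', ← ht, one_mul]
  rw [hquad (1 / 2 * t), hquad t, hzero]
  ring

omit [Fintype V] [DecidableEq V] in
/-- **The cleared (HCOV) functional along the leaf weight of a pendant path `a₃ – v – x`**: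
`Gc(p[f ↦ s]) = Gc(p[f' ↦ 0][f ↦ s · p f']) ends[f ↦ {a₃, x}]`. -/
theorem Gc_leaf_series (hp : IsProbVec p) (hff : f ≠ f') (hf : ends f = s(a₃, v))
    (hf' : ends f' = s(v, x)) (hdeg : ∀ e, v ∈ ends e → e = f ∨ e = f') (h3v : a₃ ≠ v)
    (hvx : v ≠ x) {o a₁ a₂ b : V} (hvo : v ≠ o) (hv1 : v ≠ a₁) (hv2 : v ≠ a₂) (hvb : v ≠ b)
    (s : R) (hs0 : 0 ≤ s) (hs1 : s ≤ 1) :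
    Gc (Function.update p f s) ends o a₁ a₂ a₃ b =
      Gc (Function.update (Function.update p f' 0) f (s * p f'))
        (Function.update ends f s(a₃, x)) o a₁ a₂ a₃ b := by
  have hfv : ends f = s(v, a₃) := by rw [hf, Sym2.eq_swap]
  have h1 := Gc_series (Function.update p f s) hff hfv hf' hdeg h3v.symm hvx hvo.symm hv1.symm
    hv2.symm h3v hvb.symm (o := o) (a₁ := a₁) (a₂ := a₂) (a₃ := a₃) (b := b)
  rw [Function.update_self, Function.update_of_ne hff.symm, Function.update_idem] at h1
  rw [← h1]
  have hp₁ : IsProbVec (Function.update (Function.update p f (s * p f')) f' 1) :=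
    (hp.update f (mul_nonneg hs0 (hp.nonneg f')) (mul_le_one₀ hs1 (hp.nonneg f') (hp.le_one f'))).update
      f' zero_le_one le_rfl
  have hsure : (Function.update (Function.update p f (s * p f')) f' 1) f' = 1 := Function.update_self ..
  rw [Gc_reend_of_sure _ hp₁ hsure hfv hf' hdeg h3v.symm hvx hvo.symm hv1.symm hv2.symm h3v hvb.symm]
  have hf'' : (Function.update ends f s(a₃, x)) f' = s(v, x) := by
    rw [Function.update_of_ne hff.symm, hf']
  have hleaf : ∀ e, v ∈ (Function.update ends f s(a₃, x)) e → e = f' :=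
    leaf_of_reend (w := a₃) (w' := x) hdeg h3v.symm hvx
  have hp₂ : Function.update (Function.update p f' 0) f (s * p f') =
      Function.update (Function.update (Function.update p f (s * p f')) f' 1) f' 0 := by
    rw [Function.update_idem, Function.update_comm hff]
  rw [hp₂, Gc_update_leaf _ hf'' hleaf hvx hvo hv1 hv2 h3v.symm hvb 0]

omit [Fintype V] [DecidableEq V] in
/-- **The quadratic coefficient `c₂` of the (HCOV) leaf step transports along a series edge**:
`c₂ at v = (p f')² · c₂ at x` (the `Gc` companion of `kappa_series`, with no hypothesis on the
isolated value `Gc(p[f ↦ 0])`). -/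
theorem c2_series (hp : IsProbVec p) (hff : f ≠ f') (hf : ends f = s(a₃, v))
    (hf' : ends f' = s(v, x)) (hdeg : ∀ e, v ∈ ends e → e = f ∨ e = f') (h3v : a₃ ≠ v)
    (hvx : v ≠ x) (h3x : a₃ ≠ x) (hleaf3 : ∀ e, a₃ ∈ ends e → e = f) {o a₁ a₂ b : V} (hvo : v ≠ o)
    (hv1 : v ≠ a₁) (hv2 : v ≠ a₂) (hvb : v ≠ b) (h31 : a₃ ≠ a₁) (h32 : a₃ ≠ a₂) (h3o : a₃ ≠ o)
    (h3b : a₃ ≠ b) :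
    A3Leaf.c2 p ends f o a₁ a₂ a₃ b =
      (p f') ^ 2 * A3Leaf.c2 (Function.update p f' 0) (Function.update ends f s(a₃, x)) f
        o a₁ a₂ a₃ b := by
  set t := p f' with ht
  set q := Function.update p f' 0 with hq
  set ends' := Function.update ends f s(a₃, x) with hends'
  have hfx : ends' f = s(a₃, x) := by rw [hends', Function.update_self]
  have hleaf' : ∀ e, a₃ ∈ ends' e → e = f := by
    intro e he
    by_cases hef : e = f
    · exact hef
    · rw [hends', Function.update_of_ne hef] at he
      exact hleaf3 e he
  have hquad := A3Leaf.Gc_leaf_eq q hfx hleaf' h3x h31 h32 h3o h3b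
  have e0 := Gc_leaf_series p ends hp hff hf hf' hdeg h3v hvx hvo hv1 hv2 hvb (0 : R) le_rfl
    zero_le_one (o := o) (a₁ := a₁) (a₂ := a₂) (b := b)
  have e1 := Gc_leaf_series p ends hp hff hf hf' hdeg h3v hvx hvo hv1 hv2 hvb (1 / 2 : R)
    (by norm_num) (by norm_num) (o := o) (a₁ := a₁) (a₂ := a₂) (b := b)
  have e2 := Gc_leaf_series p ends hp hff hf hf' hdeg h3v hvx hvo hv1 hv2 hvb (1 : R)
    zero_le_one le_rfl (o := o) (a₁ := a₁) (a₂ := a₂) (b := b)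
  simp only [A3Leaf.c2]
  rw [e0, e1, e2]
  rw [← hq, ← hends', ← ht, one_mul, zero_mul]
  rw [hquad (1 / 2 * t), hquad t]
  simp only [A3Leaf.c2]
  ring

end Kappa

end SeriesCollapse

end Summit.Ventures.PercRepro2
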